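import Summits.QuantumFields.YangMills.Theorems.BalabanUVNodesN08AtRecord13Co
import Summits.QuantumFields.YangMills.Theorems.BalabanUVNodesN08AtRecord13LaneFamily

/-!
# BalabanUVNodes ∕ N08 THROUGH THE RE-BOUND [B10] LAYER OF THE ₁₃ CARRIER STACK, AT PRINT'S BACKGROUND — the Co ∕ Core re-key (KEY-RULE-21) of
# `BalabanUVNodesN08AtRecord13LaneFamily` (p495845): N08 AT A Co-BACKGROUND STAGE-13 RECORD (`IsRecordOfRecord₁₃CCo`, def-T FILE 21) WHOSE [B10] LAYER IS RE-BOUND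
# (dag-n10-d FILE 4: `Stage13Params.toStage5₁₃Co_rebindX`, `isRecordOfRecord₁₃CCo_rebindX_of_eq`, `exists_world_isRecordOfRecord₁₃CCo_rebindX`, `datumOfRecord₁₃Co_rebindX`) TO AN
# EXHIBITED FAMILY OF [B10] TOWER RUNS carrying Thm 1-compact ∧ Thm 2 — instance: dag-n08-d's CONSTRUCTED d = 3 LANE FAMILY from «cluster-expansion DATA ∧ three in-edge faces»
# (Track A, DAG node N08 [Balaban1985UV3] CMP **102** (1985) 255, Thm 1 p. 257 (compact reading) + Thm 2 p. 272; R134 fan-out seat `pub-ymgap-dag-n08-c` g15, strategy s2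
# «knit at the record of record», trigger (t19‴) = def-T KEY-21C; dag-lead ORPHAN-STOREYS row A1 (file 3 of 5), 2026-08-27)

WHY THIS FILE.  p495845 binds its worlds over `(θ.rebindX …).toStage5₁₃` and keys on `Provisos₁₃ ∕ datumOfRecord₁₃ ∕ IsRecordOfRecord₁₃C` (U_old); under director-ym LINE №152
RULING (β) the record is re-based ONCE at print's background, so its §2 ∕ §2b ∕ §3 theorems are re-typed here as IMAGES under KEY-RULE-21 (`IsRecordOfRecord₁₃C ↦
IsRecordOfRecord₁₃CCo`, `(h : Provisos₁₃) ↦ (h : Provisos₁₃Core)`, `datumOfRecord₁₃ ↦ datumOfRecord₁₃Co`, `toStage5₁₃ ↦ toStage5₁₃Co`) over dag-n10-d's Co re-binding faces.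
CITED from p495845, not re-declared (θ-free or background-free, dag-lead DEDUP-113): §1's `Stage5Params`-generic faces `N08AtRecord13LaneFamily.b10Compact_withTowerRuns10_iff ∕
upOfRecord₅C_rebindX_withTowerRuns10_b10_iff(_b10Compact) ∕ b10Compact_withTowerRuns10_of_isEmpty` (the VACUITY CERTIFICATE stands: an EMPTY re-bound family carries the
compact node outright, so content enters only through the EXHIBITED family), §2b's `upOfRecord₅C_rebindX_towerRuns_pin3_b10_iff`, §3's `b10Compact_laneFamily_of_data_faces₃` and
`nonempty_laneIndex`.  NOT imaged: p495845's ★★ `…_of_bg_numerics_two` (its hypothesis is K0a's U_old row-P11 socket text at `UbgOfRecord₁₃`; the Co socket is node00-def-K0a's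
15a ∕ 15b).

WHAT IS PROVED (kernel bookkeeping BY NAME; 0 `def`, 0 `sorry`).
* §2 at a ₁₃CCo record whose [B10] layer is re-bound to a tower-run family `T` (generic, displayed as DATA `hT : ∀ P, b10Compact ((Xc P).withTowerRuns10 T)`): exact leaf ∕
  exact reading ∕ POINTED CLOSER at a world bound over `(θ.rebindX …).toStage5₁₃Co` (`b10_leaf_iff_ ∕ b10_main_iff_ ∕ b10_main_of_up_rebindX_towerRuns`); ∃-CURRENCY
  `exists_world₁₃CCo_rebindX_towerRuns_b10_main` (n10-d's `exists_world_isRecordOfRecord₁₃CCo_rebindX`); N08's conjunct shape `exists_guarded_record₁₃CCo_b10_main_of_towerRuns`;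
* §2b the pointed closer ∕ exact leaf over the lane-keyed four-layer Co word `((((θ.rebindX …).pinY Y₀).pinZ Z₀).pinW W₀).toStage5₁₃Co` (n10-d's four `toStage5₁₃Co_<pin>` `rfl`s);
* §3 THE LANE INSTANCE `T :=` dag-n08-d's constructed family on `ScalesLE θ.L ((min γ_N08 1)²)` from «DATA ∧ three faces» (p495845's `b10Compact_laneFamily_of_data_faces₃`, cited):
  `exists_world₁₃CCo_laneFamily_b10_main_of_data_faces₃`, `exists_guarded_record₁₃CCo_laneFamily_b10_main_of_data_faces₃`, ★ `…_of_inhabited13Core` (+ `_two` at `N = 2`).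
HONEST FRAMING — PLEASE READ.  The re-bound [B10] layer here is THE LANE'S FAMILY (d = 3 small-field programme, given its external inputs), NOT print's run family of record
(`runsB10OfRecord`, the `pinB10` layer), hence NOT the slot `Node00.PrintedUV3V N θ.L` and NOT a re-pointing of S1; count-neutral re-keying of a LANDED storey to the corrected
record (new file; p495845 stays as the pre-№152 sibling).  The DATA schema `RunDataRows` (the [B10] §§2–3 cluster expansion at the lane's run objects — class II of the n08-b
census = the object gap in data form), the three in-edge faces `InEdgeFaces₃`, the Core provisos, admissibility, the guard and every window inequality are DISPLAYED hypotheses;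
nothing of Bałaban's asserted; K0 ∕ K1 neither proved nor assumed; N08 NOT discharged; one finite four-torus per run at fixed `ε`; nothing continuum ∕ ℝ⁴ ∕ OS ∕ mass gap ∕ Clay.
Sources: [Balaban1985UV3] Thm 1 p.257, Thm 2 p.272, (1)–(5) p.256, p.256 L15–18; [Balaban1989LargeFieldII] Thm 1 + (0.1) pp.355–356; [Balaban1988Convergent] p.244, (2.18) p.257,
(3.16)–(3.22) pp.268–269; [Balaban1989LargeFieldI] (0.2) p.176, (0.3)–(0.4) p.176.
-/

noncomputable section

namespace Summit.QuantumFields.YangMills.BalabanUVNodes.N08AtRecord13CoLaneFamily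

open MeasureTheory
open scoped BigOperators Matrix.Norms.L2Operator
open Literature.MathematicalPhysics.QuantumFieldTheory.Balaban1983to89
open Literature.MathematicalPhysics.QuantumFieldTheory.Balaban1983to89.B10
open Literature.MathematicalPhysics.QuantumFieldTheory.Balaban1983to89.B10SectCExpansion (TermSizes)
open Literature.MathematicalPhysics.QuantumFieldTheory.Balaban1985CMP102
open Literature.MathematicalPhysics.QuantumFieldTheory.Balaban1985CMP102.Setting
open Literature.MathematicalPhysics.QuantumFieldTheory.Balaban1985CMP102.Theorems (Family runs)
open Literature.MathematicalPhysics.QuantumFieldTheory.Balaban1983to89.T4Continuum (T4Family FiniteEpsData)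
open Literature.MathematicalPhysics.QuantumFieldTheory.Balaban1983to89.DagBinding (leavesP WorldP PrintedCarriersR PrintedCarriers9X PrintedCarriers11 PrintedCarriers15)
open Literature.MathematicalPhysics.QuantumFieldTheory.Balaban1983to89.DagDischarged (b10Compact)
open Literature.MathematicalPhysics.QuantumFieldTheory.Balaban1983to89.Node00
open Summit.QuantumFields.Balaban3D.Carriers
open Summit.QuantumFields.Balaban3D.Proofs.Inputs
open Summit.QuantumFields.Balaban3D.Proofs.Primitives (AlphaConsts)
open Summit.QuantumFields.Balaban3D.Proofs.GroupModelLieC (lieC)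
open Summit.QuantumFields.Balaban3D.Proofs.UVStability3DInputs
open Summit.QuantumFields.Balaban3D.Proofs.FamilyLE (ScalesLE)
open Summit.QuantumFields.YangMills.Theorems.BalabanUVNodesN08AlphaClassI
open Summit.QuantumFields.YangMills.Theorems.BalabanUVNodesN08AlphaLoop28
open Summit.QuantumFields.YangMills.Theorems.BalabanUVNodesN08AlphaThreeFaces
open Summit.QuantumFields.YangMills.BalabanUVNodes.N08AtStage5View (b10_main_of_up_eq b10_leaf_iff_of_up_eq b10_main_iff_of_up_eq b10Face_pinY b10Face_pinZ b10Face_pinW)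
open Summit.QuantumFields.YangMills.BalabanUVNodes.N08AtRecord13Co

variable {F : T4Family} {N : ℕ} [NeZero N]

/-! ## §2 N08 AT A ₁₃CCo RECORD WHOSE [B10] LAYER IS RE-BOUND TO A TOWER-RUN FAMILY `T` CARRYING Thm 1-compact ∧ Thm 2 (generic `T`, displayed as DATA) -/

section Generic
variable (θ : Stage13Params F N) (Xc : B12.RunParams → PrintedCarriersR) {I : Type} (T : I → B10.TowerRun) {w : WorldP}

/-- **EXACT LEAF at a world bound over the re-bound Stage-13 view**: `b10 ⟺ b10Compact ((Xc P).withTowerRuns10 T)`. [cite: Balaban1985UV3, Thm 1 p.257 (compact reading) + Thm 2 p.272] -/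
theorem b10_leaf_iff_of_up_rebindX_towerRuns
    (hup : ∀ P, w.up P = upOfRecord₅C F N ((θ.rebindX F N fun P => (Xc P).withTowerRuns10 T).toStage5₁₃Co F N) P) (P : B12.RunParams) :
    (leavesP w P).b10 ↔ b10Compact ((Xc P).withTowerRuns10 T).toPrintedCarriers :=
  b10_leaf_iff_of_up_eq (hup P) (N08AtRecord13LaneFamily.upOfRecord₅C_rebindX_withTowerRuns10_b10_iff_b10Compact _ Xc T P)

/-- **EXACT READING OF N08 there**: `Dag.B10_main ⟺ (in-edge leaves ⟹ b10Compact ((Xc P).withTowerRuns10 T))`. [cite: Balaban1985UV3, Thm 1 p.257 (compact reading) + Thm 2 p.272] -/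
theorem b10_main_iff_of_up_rebindX_towerRuns
    (hup : ∀ P, w.up P = upOfRecord₅C F N ((θ.rebindX F N fun P => (Xc P).withTowerRuns10 T).toStage5₁₃Co F N) P) (P : B12.RunParams) :
    Dag.B10_main (leavesP w P) ↔
      ((leavesP w P).b5 → (leavesP w P).b6 → (leavesP w P).b7 → (leavesP w P).b8 → (leavesP w P).b9 → (leavesP w P).b11 →
        b10Compact ((Xc P).withTowerRuns10 T).toPrintedCarriers) :=
  b10_main_iff_of_up_eq (hup P) (N08AtRecord13LaneFamily.upOfRecord₅C_rebindX_withTowerRuns10_b10_iff_b10Compact _ Xc T P)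

/-- **POINTED CLOSER**: at a world bound over the re-bound Stage-13 view, N08 at every run ⟸ the compact node of the re-bound carriers at every run (in-edges unused;
this seat's generic `N08AtStage5View.b10_main_of_up_eq`). [cite: Balaban1985UV3, Thm 1 p.257 (compact reading) + Thm 2 p.272] -/
theorem b10_main_of_up_rebindX_towerRuns
    (hup : ∀ P, w.up P = upOfRecord₅C F N ((θ.rebindX F N fun P => (Xc P).withTowerRuns10 T).toStage5₁₃Co F N) P)
    (hT : ∀ P : B12.RunParams, b10Compact ((Xc P).withTowerRuns10 T).toPrintedCarriers) (P : B12.RunParams) :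
    Dag.B10_main (leavesP w P) :=
  b10_main_of_up_eq (hup P) (N08AtRecord13LaneFamily.upOfRecord₅C_rebindX_withTowerRuns10_b10_iff_b10Compact _ Xc T P) (hT P)

variable {θ}

/-- **∃-CURRENCY**: at the datum of ANY admissible Stage-13 tuple with provisos, a world (any window `γw`, block size `θ.L`) that IS a ₁₃CCo record of `datumOfRecord₁₃Co F N θ h`,
bound over the Stage-13 view with the [B10] layer re-bound to `P ↦ (Xc P).withTowerRuns10 T`, carrying N08 at every run — from the compact node of those carriers
(dag-n10-d's `exists_world_isRecordOfRecord₁₃CCo_rebindX` + the pointed closer). [cite: Balaban1985UV3, Thm 1 p.257 (compact reading) + Thm 2 p.272; Balaban1989LargeFieldII, Thm 1 + (0.1) pp.355–356 (the record's world; bookkeeping)] -/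
theorem exists_world₁₃CCo_rebindX_towerRuns_b10_main (h : θ.Provisos₁₃Core F N) (hθ : θ.Admissible F N) {γw : ℝ} (hγw : 0 < γw ∧ γw ≤ θ.γ)
    (hT : ∀ P : B12.RunParams, b10Compact ((Xc P).withTowerRuns10 T).toPrintedCarriers) :
    ∃ w : WorldP, IsRecordOfRecord₁₃CCo F N (datumOfRecord₁₃Co F N θ h) w ∧ w.γ = γw ∧ w.L = (θ.L : ℝ) ∧
      (∀ P, w.up P = upOfRecord₅C F N ((θ.rebindX F N fun P => (Xc P).withTowerRuns10 T).toStage5₁₃Co F N) P) ∧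
      ∀ P : B12.RunParams, Dag.B10_main (leavesP w P) := by
  obtain ⟨w, hR, hγ, hL, hup⟩ := exists_world_isRecordOfRecord₁₃CCo_rebindX F N θ h hθ (fun P => (Xc P).withTowerRuns10 T) hγw
  exact ⟨w, hR, hγ, hL, hup, b10_main_of_up_rebindX_towerRuns θ Xc T hup hT⟩

/-- **N08's CONJUNCT SHAPE OF A CORE-KEYED `NodesAtSomeRecord13`, WITNESSED AT `θ` ITSELF** (guard and admissibility read at `θ`; the presenting re-bound parameter is inside the ∃
of `IsRecordOfRecord₁₃CCo`): from provisos, admissibility, the guard, and the compact node of the re-bound carriers at every run. [cite: Balaban1985UV3, Thm 1 p.257 (compact reading) + Thm 2 p.272; Balaban1989LargeFieldII, Thm 1 + (0.1) pp.355–356; Balaban1988Convergent, (3.16)–(3.22) pp.268–269 (the guard; bookkeeping)] -/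
theorem exists_guarded_record₁₃CCo_b10_main_of_towerRuns (h : θ.Provisos₁₃Core F N) (hθ : θ.Admissible F N) (hG : θ.ZtUnity F N ∧ θ.SlotsNondegenerate₁₃ F N)
    (hT : ∀ P : B12.RunParams, b10Compact ((Xc P).withTowerRuns10 T).toPrintedCarriers) :
    ∃ (θ' : Stage13Params F N) (h' : θ'.Provisos₁₃Core F N) (w : WorldP), (θ'.ZtUnity F N ∧ θ'.SlotsNondegenerate₁₃ F N) ∧ θ'.Admissible F N ∧
      IsRecordOfRecord₁₃CCo F N (datumOfRecord₁₃Co F N θ' h') w ∧ ∀ P : B12.RunParams, Dag.B10_main (leavesP w P) := by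
  obtain ⟨w, hR, -, -, -, hN⟩ := exists_world₁₃CCo_rebindX_towerRuns_b10_main Xc T h hθ ⟨hθ.toStage9.gamma_pos, le_rfl⟩ hT
  exact ⟨θ, h, w, hG, hθ, hR, hN⟩

end Generic

/-! ## §2b THE SAME LEAF THROUGH THE THREE OUTER PINS — over `(((σ.rebindX …).pinY Y₀).pinZ Z₀).pinW W₀` (the word a four-pin pointed Stage-13 assembler binds over, with the
lane family in the [B10] slot instead of print's; this seat's `N08AtStage5View.b10Face_pinY ∕ _pinZ ∕ _pinW` BY NAME) -/

section Pin3
variable (Xc : B12.RunParams → PrintedCarriersR) {I : Type} (T : I → B10.TowerRun) (Y₀ : PrintedCarriers9X) (Z₀ : PrintedCarriers11)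
  (W₀ : B12.RunParams → PrintedCarriers15)

/-- **POINTED CLOSER over the lane-keyed four-layer Stage-13 word** `((((θ.rebindX …).pinY Y₀).pinZ Z₀).pinW W₀).toStage5₁₃Co` (= the Stage-5 word at `σ := θ.toStage5₁₃Co`,
dag-n10-d's `toStage5₁₃Co_rebindX ∕ _pinY ∕ _pinZ ∕ _pinW`, `rfl`): N08 at every run ⟸ the compact node of the re-bound carriers at every run — the `h10leaf` line of a four-pin
pointed assembler that takes N08 from the (α) programme. [cite: Balaban1985UV3, Thm 1 p.257 (compact reading) + Thm 2 p.272] -/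
theorem b10_main_of_up_rebindX_towerRuns_pin3 (θ : Stage13Params F N) {w : WorldP}
    (hup : ∀ P, w.up P = upOfRecord₅C F N
      (((((θ.rebindX F N fun P => (Xc P).withTowerRuns10 T).pinY F N Y₀).pinZ F N Z₀).pinW F N W₀).toStage5₁₃Co F N) P)
    (hT : ∀ P : B12.RunParams, b10Compact ((Xc P).withTowerRuns10 T).toPrintedCarriers) (P : B12.RunParams) :
    Dag.B10_main (leavesP w P) :=
  b10_main_of_up_eq ((hup P).trans (by
      rw [Stage13Params.toStage5₁₃Co_pinW, Stage13Params.toStage5₁₃Co_pinZ, Stage13Params.toStage5₁₃Co_pinY, Stage13Params.toStage5₁₃Co_rebindX]))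
    (N08AtRecord13LaneFamily.upOfRecord₅C_rebindX_towerRuns_pin3_b10_iff Xc T Y₀ Z₀ W₀ (θ.toStage5₁₃Co F N) P) (hT P)

/-- … and the exact leaf there. [cite: Balaban1985UV3, Thm 1 p.257 (compact reading) + Thm 2 p.272] -/
theorem b10_leaf_iff_of_up_rebindX_towerRuns_pin3 (θ : Stage13Params F N) {w : WorldP}
    (hup : ∀ P, w.up P = upOfRecord₅C F N
      (((((θ.rebindX F N fun P => (Xc P).withTowerRuns10 T).pinY F N Y₀).pinZ F N Z₀).pinW F N W₀).toStage5₁₃Co F N) P) (P : B12.RunParams) :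
    (leavesP w P).b10 ↔ b10Compact ((Xc P).withTowerRuns10 T).toPrintedCarriers :=
  b10_leaf_iff_of_up_eq ((hup P).trans (by
      rw [Stage13Params.toStage5₁₃Co_pinW, Stage13Params.toStage5₁₃Co_pinZ, Stage13Params.toStage5₁₃Co_pinY, Stage13Params.toStage5₁₃Co_rebindX]))
    (N08AtRecord13LaneFamily.upOfRecord₅C_rebindX_towerRuns_pin3_b10_iff Xc T Y₀ Z₀ W₀ (θ.toStage5₁₃Co F N) P)

end Pin3

/-! ## §3 THE LANE INSTANCE: dag-n08-d's CONSTRUCTED FAMILY `S ↦ towerOf 𝔠.lane (X S) (𝔖 S)` ON THE N08 WINDOW `ScalesLE θ.L ((min γ_N08 1)²)` AT THE RECORD'S BLOCK SIZE,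
from «cluster-expansion DATA schema ∧ three in-edge faces» BY NAME (`b10Compact_constructedLE_of_faces₃_family`) -/

section Lane
variable {G : Type} [GaugeGroup G] [MeasurableSpace G] [HaarData G] {𝔊 : GroupModel G}

/-- **A ₁₃CCo RECORD OF `datumOfRecord₁₃Co F N θ h` BOUND OVER THE LANE-RE-BOUND STAGE-13 VIEW, CARRYING N08 AT EVERY RUN, from «DATA ∧ three faces»** (any window `γw`, block
size `θ.L`).  The world at which a pointed Stage-13 assembler wanting N08 from the (α) programme — rather than from the slot of record — presents the other nodes.
[cite: Balaban1985UV3, Thm 1 p.257 (compact reading) + Thm 2 p.272; Balaban1989LargeFieldII, Thm 1 + (0.1) pp.355–356 (bookkeeping)] -/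
theorem exists_world₁₃CCo_laneFamily_b10_main_of_data_faces₃ (θ : Stage13Params F N) (h : θ.Provisos₁₃Core F N) (hθ : θ.Admissible F N)
    {𝔠 : AlphaConsts θ.L 𝔊.N} {X : ∀ S : Scales θ.L, ExternalInputs S G}
    {𝔖 : ∀ (S : Scales θ.L) (k : ℕ), StepSeries S G ↥(lieC 𝔊) (nblkOf S 𝔠.lane.carrier k) k} {𝔄 : ∀ S : Scales θ.L, AlphaData 𝔊 𝔠 (X S) (𝔖 S)}
    (coef : ∀ (S : Scales θ.L) (k : ℕ), Hist S.P (k + 1) → GaugeField S.P (k + 1) G → (j : ℕ) → TermSizes (oldGeom S.P k j))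
    (hD : ∀ S : Scales θ.L, S.g ^ 2 * S.ε₀ ≤ (min (gammaN08 𝔠) 1) ^ 2 → RunDataRows 𝔊 𝔠 (X S) (𝔖 S) (𝔄 S) (sizesOf 𝔊 𝔠 (X S) (coef S)))
    (hF : ∀ S : Scales θ.L, S.g ^ 2 * S.ε₀ ≤ (min (gammaN08 𝔠) 1) ^ 2 → InEdgeFaces₃ 𝔊 (regMin 𝔠) (X S))
    {γw : ℝ} (hγw : 0 < γw ∧ γw ≤ θ.γ) :
    ∃ w : WorldP, IsRecordOfRecord₁₃CCo F N (datumOfRecord₁₃Co F N θ h) w ∧ w.γ = γw ∧ w.L = (θ.L : ℝ) ∧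
      (∀ P, w.up P = upOfRecord₅C F N ((θ.rebindX F N fun P => (θ.res.X P).withTowerRuns10
        fun S : ScalesLE θ.L ((min (gammaN08 𝔠) 1) ^ 2) => towerOf 𝔠.lane (X S.1) (𝔖 S.1)).toStage5₁₃Co F N) P) ∧
      ∀ P : B12.RunParams, Dag.B10_main (leavesP w P) :=
  exists_world₁₃CCo_rebindX_towerRuns_b10_main _ _ h hθ hγw (N08AtRecord13LaneFamily.b10Compact_laneFamily_of_data_faces₃ θ coef hD hF)

/-- **N08's CONJUNCT SHAPE OF `NodesAtSomeRecord13`, WITNESSED AT `θ`, from «DATA ∧ three faces» at block size `θ.L`** (plus `θ`'s provisos, admissibility and guard).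
[cite: Balaban1985UV3, Thm 1 p.257 (compact reading) + Thm 2 p.272; Balaban1989LargeFieldII, Thm 1 + (0.1) pp.355–356; Balaban1988Convergent, (3.16)–(3.22) pp.268–269 (bookkeeping)] -/
theorem exists_guarded_record₁₃CCo_laneFamily_b10_main_of_data_faces₃ (θ : Stage13Params F N) (h : θ.Provisos₁₃Core F N) (hθ : θ.Admissible F N)
    (hG : θ.ZtUnity F N ∧ θ.SlotsNondegenerate₁₃ F N) {𝔠 : AlphaConsts θ.L 𝔊.N} {X : ∀ S : Scales θ.L, ExternalInputs S G}
    {𝔖 : ∀ (S : Scales θ.L) (k : ℕ), StepSeries S G ↥(lieC 𝔊) (nblkOf S 𝔠.lane.carrier k) k} {𝔄 : ∀ S : Scales θ.L, AlphaData 𝔊 𝔠 (X S) (𝔖 S)}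
    (coef : ∀ (S : Scales θ.L) (k : ℕ), Hist S.P (k + 1) → GaugeField S.P (k + 1) G → (j : ℕ) → TermSizes (oldGeom S.P k j))
    (hD : ∀ S : Scales θ.L, S.g ^ 2 * S.ε₀ ≤ (min (gammaN08 𝔠) 1) ^ 2 → RunDataRows 𝔊 𝔠 (X S) (𝔖 S) (𝔄 S) (sizesOf 𝔊 𝔠 (X S) (coef S)))
    (hF : ∀ S : Scales θ.L, S.g ^ 2 * S.ε₀ ≤ (min (gammaN08 𝔠) 1) ^ 2 → InEdgeFaces₃ 𝔊 (regMin 𝔠) (X S)) :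
    ∃ (θ' : Stage13Params F N) (h' : θ'.Provisos₁₃Core F N) (w : WorldP), (θ'.ZtUnity F N ∧ θ'.SlotsNondegenerate₁₃ F N) ∧ θ'.Admissible F N ∧
      IsRecordOfRecord₁₃CCo F N (datumOfRecord₁₃Co F N θ' h') w ∧ ∀ P : B12.RunParams, Dag.B10_main (leavesP w P) :=
  exists_guarded_record₁₃CCo_b10_main_of_towerRuns _ _ h hθ hG (N08AtRecord13LaneFamily.b10Compact_laneFamily_of_data_faces₃ θ coef hD hF)

/-- **★ «A CORE-KEYED INHABITATION ⟹ N08's CONJUNCT OF A CORE-KEYED STAGE-13 NODES-∃» THROUGH THE LANE, generic `N`**: from `∃ θ, Provisos₁₃Core ∧ (ZtUnity ∧ SlotsNondegenerate₁₃) ∧ Admissible`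
at `F` (HYPOTHESIS `hI`) and, AT EVERY ODD BLOCK SIZE `L > 1`, lane objects `(𝔠, X, 𝔖, 𝔄, coef)` carrying the DATA schema and the three in-edge faces on the N08 window
(HYPOTHESIS `hlane` — the (α) programme's displayed inputs, in place of the slot socket `∀ L, Odd L → 1 < L → PrintedUV3V N L` of `N08AtRecord13Co` §2).  NOT the stub, NOT a
discharge; the [B10] layer is the lane's, not print's (module docstring). [cite: Balaban1985UV3, Thm 1 p.257 (compact reading) + Thm 2 p.272 + p.256 L15–18; Balaban1989LargeFieldII, Thm 1 + (0.1) pp.355–356 (bookkeeping)] -/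
theorem exists_guarded_record₁₃CCo_laneFamily_b10_main_of_inhabited13Core
    (hI : ∃ θ : Stage13Params F N, θ.Provisos₁₃Core F N ∧ (θ.ZtUnity F N ∧ θ.SlotsNondegenerate₁₃ F N) ∧ θ.Admissible F N)
    (hlane : ∀ L : ℕ, Odd L → 1 < L →
      ∃ (𝔠 : AlphaConsts L 𝔊.N) (X : ∀ S : Scales L, ExternalInputs S G)
        (𝔖 : ∀ (S : Scales L) (k : ℕ), StepSeries S G ↥(lieC 𝔊) (nblkOf S 𝔠.lane.carrier k) k) (𝔄 : ∀ S : Scales L, AlphaData 𝔊 𝔠 (X S) (𝔖 S))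
        (coef : ∀ (S : Scales L) (k : ℕ), Hist S.P (k + 1) → GaugeField S.P (k + 1) G → (j : ℕ) → TermSizes (oldGeom S.P k j)),
        (∀ S : Scales L, S.g ^ 2 * S.ε₀ ≤ (min (gammaN08 𝔠) 1) ^ 2 → RunDataRows 𝔊 𝔠 (X S) (𝔖 S) (𝔄 S) (sizesOf 𝔊 𝔠 (X S) (coef S))) ∧
        (∀ S : Scales L, S.g ^ 2 * S.ε₀ ≤ (min (gammaN08 𝔠) 1) ^ 2 → InEdgeFaces₃ 𝔊 (regMin 𝔠) (X S))) :
    ∃ (θ : Stage13Params F N) (h : θ.Provisos₁₃Core F N) (w : WorldP), (θ.ZtUnity F N ∧ θ.SlotsNondegenerate₁₃ F N) ∧ θ.Admissible F N ∧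
      IsRecordOfRecord₁₃CCo F N (datumOfRecord₁₃Co F N θ h) w ∧ ∀ P : B12.RunParams, Dag.B10_main (leavesP w P) := by
  obtain ⟨θ, h, hG, hθ⟩ := hI
  obtain ⟨𝔠, X, 𝔖, 𝔄, coef, hD, hF⟩ := hlane θ.L θ.hL.1 θ.hL.2
  exact exists_guarded_record₁₃CCo_laneFamily_b10_main_of_data_faces₃ θ h hθ hG (𝔄 := 𝔄) coef hD hF

/-- **★ THE SAME AT THE GROUP OF RECORD `N = 2`**, hypothesis `hI` = the Core-keyed inhabitation text (the rev-16 K0‴ body under `Provisos₁₃ ↦ Provisos₁₃Core`).  Intended lane group: `G := SU(2)`. [cite: Balaban1985UV3, Thm 1 p.257 (compact reading) + Thm 2 p.272; Balaban1989LargeFieldII, Thm 1 + (0.1) pp.355–356 (bookkeeping)] -/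
theorem exists_guarded_record₁₃CCo_laneFamily_b10_main_of_inhabited13Core_two (F : T4Family)
    (hI : ∃ θ : Stage13Params F 2, θ.Provisos₁₃Core F 2 ∧ (θ.ZtUnity F 2 ∧ θ.SlotsNondegenerate₁₃ F 2) ∧ θ.Admissible F 2)
    (hlane : ∀ L : ℕ, Odd L → 1 < L →
      ∃ (𝔠 : AlphaConsts L 𝔊.N) (X : ∀ S : Scales L, ExternalInputs S G)
        (𝔖 : ∀ (S : Scales L) (k : ℕ), StepSeries S G ↥(lieC 𝔊) (nblkOf S 𝔠.lane.carrier k) k) (𝔄 : ∀ S : Scales L, AlphaData 𝔊 𝔠 (X S) (𝔖 S))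
        (coef : ∀ (S : Scales L) (k : ℕ), Hist S.P (k + 1) → GaugeField S.P (k + 1) G → (j : ℕ) → TermSizes (oldGeom S.P k j)),
        (∀ S : Scales L, S.g ^ 2 * S.ε₀ ≤ (min (gammaN08 𝔠) 1) ^ 2 → RunDataRows 𝔊 𝔠 (X S) (𝔖 S) (𝔄 S) (sizesOf 𝔊 𝔠 (X S) (coef S))) ∧
        (∀ S : Scales L, S.g ^ 2 * S.ε₀ ≤ (min (gammaN08 𝔠) 1) ^ 2 → InEdgeFaces₃ 𝔊 (regMin 𝔠) (X S))) :
    ∃ (θ : Stage13Params F 2) (h : θ.Provisos₁₃Core F 2) (w : WorldP), (θ.ZtUnity F 2 ∧ θ.SlotsNondegenerate₁₃ F 2) ∧ θ.Admissible F 2 ∧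
      IsRecordOfRecord₁₃CCo F 2 (datumOfRecord₁₃Co F 2 θ h) w ∧ ∀ P : B12.RunParams, Dag.B10_main (leavesP w P) :=
  exists_guarded_record₁₃CCo_laneFamily_b10_main_of_inhabited13Core hI hlane

end Lane

end Summit.QuantumFields.YangMills.BalabanUVNodes.N08AtRecord13CoLaneFamily

end
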